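import Literature.NumberTheory.EllipticCurves.Kato2004.Condition1252
import Mathlib.LinearAlgebra.Dimension.Localization
import HarnessLib

/-!
# Kato 2004 (Astérisque 295) Thm. 13.4, hypothesis (v) for `T = T_pE` from a principal congruence
# subgroup in the `p`-adic image (theorems only; no definition, no named fact)

Topic `NumberTheory/EllipticCurves`, sub-directory `Kato2004` (namespace = path).  Seat `bsd-potss-rkm` g15
(prover; cell `bsd-potss`, item stmt-BirchSwinnertonDyer-19196 `ReducibleKatoMember` = crux M of K9 / K8-t′;
`--supports`, closes nothing).  HONEST FRAMING: BSD is not advanced; nothing is booked.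

WHY.  The tree's transcription of Kato's general Euler-system bound
(`Kato2004.thm13_4_lengthAt_fineSelmerDual_le_of_isEulerSystemClass`, `EulerSystemBoundFineSelmer.lean`) carries
Kato's hypothesis (v) of Thm. 13.4 (p. 226) — «There exists an element `σ` of `Gal(ℚ̄/ℚ(ζ_{p^∞}))` such that
`dim_L(Coker(1 − σ ; T ⊗_{O_L} L → T ⊗_{O_L} L)) = 1`» — spelled for `T = T_pW` as
`∃ σ, (σ fixes every p-power root of unity) ∧ Module.finrank ℤ_[p] (T_pW ⧸ range(ρ(σ) − 1)) = 1`.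
On the rows with Kato's (12.5.2) it is supplied by `exists_quotient_range_sub_one_equiv_of_imageContainsSL2`
(`σ ↦ (1 1; 0 1)`).  On SMALL-IMAGE rows (reducible `E[p]` = the rows of crux M; irreducible non-surjective =
the U₀-ns rows of K9/KT) (12.5.2) fails, but (v) still holds for every NON-CM curve: by Serre's open image
theorem (Silverman *AEC* III.7.9 (a): «`ρ_ℓ(G_{K̄/K})` is of finite index in `Aut(T_ℓ(E))` for all primes
`ℓ`») the `p`-adic image contains a principal congruence subgroup `1 + p^n End(T_pE)`, hence the transvection
`u = 1 + p^n e₀₁` of determinant `1`, whose `Coker(u − 1) ≅ ℤ_p/p^n ⊕ ℤ_p` has `ℤ_p`-rank `1`.  THIS FILE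
proves the second half in the kernel, with the congruence-subgroup property DISPLAYED as a hypothesis
(`exists_finrank_quotient_range_sub_one_eq_one_of_forall_congruence`); the first half is the named fact of
Serre's theorem (to be cited by name by the consumer; it is not restated here).

References: [Kato2004Asterisque] Thm. 13.4 (v) (p. 226), 14.10 (p. 241); [SilvermanAEC2009] Thm. III.7.9 (a),
Prop. III.8.1/III.8.3 (`det ρ = χ_p`); [SerreAbelianLadic1968] IV-11; tree `Kato2004/Condition1252.lean`
(`smul_eq_self_of_det_galoisRepTate_eq_one`, `finrank_tateModule_eq_two_holds`).
-/

set_option autoImplicit false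

noncomputable section

open Field WeierstrassCurve
open Literature.NumberTheory.GaloisRepresentations Literature.NumberTheory.EllipticCurves

namespace Literature.NumberTheory.EllipticCurves.Kato2004

variable (W : WeierstrassCurve ℚ) [W.IsElliptic] (p : ℕ) [Fact p.Prime]

/-- **Hypothesis (v) of Kato's Thm. 13.4 for `T_pE` from a principal congruence subgroup in the image.**
If every `ℤ_p`-linear automorphism `U` of `T_pE` with `(U − 1)(T_pE) ⊆ p^n T_pE` is `ρ_{E,p}(σ)` for some
`σ ∈ Γ_ℚ` (the image of `ρ_{E,p}` contains `1 + p^n End(T_pE)`; for `E` non-CM this is Serre's open image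
theorem, *AEC* III.7.9 (a)), then there is `σ ∈ Gal(ℚ̄/ℚ(ζ_{p^∞}))` with `Coker(ρ(σ) − 1 : T_pE → T_pE)` of
`ℤ_p`-rank `1` — verbatim the hypothesis (v) binder of
`thm13_4_lengthAt_fineSelmerDual_le_of_isEulerSystemClass`.  Witness: `ρ(σ) = 1 + N`, `N(b₀) = 0`,
`N(b₁) = p^n b₀` in a `ℤ_p`-basis `(b₀, b₁)` of `T_pE`; `det = 1` puts `σ` in `Gal(ℚ̄/ℚ(ζ_{p^∞}))`
(`smul_eq_self_of_det_galoisRepTate_eq_one`), and `T_pE / ℤ_p·p^n b₀` has rank `2 − 1 = 1` (rank–nullity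
over the domain `ℤ_p`). [cite: Kato2004Asterisque, Thm. 13.4 hypothesis (v) (p. 226)]
[cite: SilvermanAEC2009, Thm. III.7.9 (a) and Prop. III.8.3] -/
theorem exists_finrank_quotient_range_sub_one_eq_one_of_forall_congruence (n : ℕ)
    (h : ∀ U : W.tateModule p ≃ₗ[ℤ_[p]] W.tateModule p,
      (∀ x : W.tateModule p, ∃ y : W.tateModule p, U x - x = ((p : ℤ_[p]) ^ n) • y) →
      ∃ σ : absoluteGaloisGroup ℚ,
        (W.galoisRepTate p σ : W.tateModule p →ₗ[ℤ_[p]] W.tateModule p) = U) :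
    ∃ σ : absoluteGaloisGroup ℚ,
      (∀ (k : ℕ) (t : AlgebraicClosure ℚ), t ^ p ^ k = 1 → σ • t = t) ∧
        Module.finrank ℤ_[p]
          ((W.tateModule p) ⧸ LinearMap.range (W.galoisRepTate p σ - 1)) = 1 := by
  have hp : p.Prime := Fact.out
  have hp0 : (p : ℚ) ≠ 0 := Nat.cast_ne_zero.mpr hp.ne_zero
  haveI : Module.Free ℤ_[p] (W.tateModule p) := module_free_tateModule_holds W p
  haveI : Module.Finite ℤ_[p] (W.tateModule p) := module_finite_tateModule_holds W p
  set T := W.tateModule p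
  let b : Module.Basis (Fin 2) ℤ_[p] T :=
    Module.finBasisOfFinrankEq ℤ_[p] T (finrank_tateModule_eq_two_holds W p hp0)
  set q : ℤ_[p] := (p : ℤ_[p]) ^ n with hq
  have hq0 : q ≠ 0 := pow_ne_zero n (by exact_mod_cast hp.ne_zero)
  -- the nilpotent `N : b₀ ↦ 0, b₁ ↦ q • b₀`
  let N : T →ₗ[ℤ_[p]] T := b.constr ℤ_[p] ![(0 : T), q • b 0]
  have hNapply : ∀ x : T, N x = b.repr x 1 • (q • b 0) := by
    intro x
    rw [Module.Basis.constr_apply_fintype]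
    simp [Fin.sum_univ_two]
  have hN0 : N (b 0) = 0 := by rw [hNapply]; simp
  have hN1 : N (b 1) = q • b 0 := by rw [hNapply]; simp
  have hNN : N * N = 0 := by
    apply b.ext
    intro i
    fin_cases i
    · simp [hN0]
    · simp [hN1, hN0]
  -- the unipotent automorphism `U = 1 + N`
  have h1 : (1 + N) * (1 - N) = 1 := by
    rw [mul_sub, add_mul, one_mul, mul_one, add_mul, one_mul, hNN, add_zero, add_sub_cancel_right]
  have h2 : (1 - N) * (1 + N) = 1 := by
    rw [mul_add, sub_mul, one_mul, mul_one, sub_mul, one_mul, hNN, sub_zero, sub_add_cancel]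
  let U : T ≃ₗ[ℤ_[p]] T := LinearEquiv.ofLinear (1 + N) (1 - N) h1 h2
  have hU : (U : T →ₗ[ℤ_[p]] T) = 1 + N := rfl
  have hUcong : ∀ x : T, ∃ y : T, U x - x = q • y := by
    intro x
    refine ⟨b.repr x 1 • b 0, ?_⟩
    change (1 + N) x - x = _
    rw [LinearMap.add_apply, Module.End.one_apply, add_sub_cancel_left, hNapply, smul_comm]
  obtain ⟨σ, hσ⟩ := h U hUcong
  -- `det ρ(σ) = 1`, so `σ ∈ Gal(ℚ̄/ℚ(ζ_{p^∞}))`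
  have hmatN : LinearMap.toMatrix b b N = !![0, q; 0, 0] := by
    ext i j
    fin_cases i <;> fin_cases j <;> simp [LinearMap.toMatrix_apply, hN0, hN1]
  have hdet : LinearMap.det (W.galoisRepTate p σ : T →ₗ[ℤ_[p]] T) = 1 := by
    rw [hσ, hU, ← LinearMap.det_toMatrix b, map_add, LinearMap.toMatrix_one, hmatN]
    simp [Matrix.det_fin_two]
  refine ⟨σ, smul_eq_self_of_det_galoisRepTate_eq_one W p σ hdet, ?_⟩
  -- `range(ρ(σ) − 1) = range N = ℤ_p · (q • b₀)`
  have hsub : (W.galoisRepTate p σ : T →ₗ[ℤ_[p]] T) - 1 = N := by rw [hσ, hU, add_sub_cancel_left]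
  have hrange : LinearMap.range ((W.galoisRepTate p σ : T →ₗ[ℤ_[p]] T) - 1) = Submodule.span ℤ_[p] {q • b 0} := by
    rw [hsub]
    apply le_antisymm
    · rintro _ ⟨x, rfl⟩
      rw [hNapply]
      exact Submodule.smul_mem _ _ (Submodule.mem_span_singleton_self _)
    · rw [Submodule.span_le, Set.singleton_subset_iff]
      exact ⟨b 1, hN1⟩
  -- rank–nullity over the domain `ℤ_p`: `rank (T ⧸ ℤ_p v) + 1 = 2`
  have hv0 : q • b 0 ≠ 0 := smul_ne_zero hq0 (b.ne_zero 0)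
  have hspan : Module.rank ℤ_[p] (Submodule.span ℤ_[p] ({q • b 0} : Set T)) = 1 := by
    rw [rank_span_set (LinearIndepOn.singleton (v := id) hv0), Cardinal.mk_singleton]
  have hT : Module.rank ℤ_[p] T = 2 := by
    rw [← Module.finrank_eq_rank, finrank_tateModule_eq_two_holds W p hp0]; rfl
  have hadd := rank_quotient_add_rank_of_isDomain (Submodule.span ℤ_[p] ({q • b 0} : Set T))
  rw [hspan, hT] at hadd
  have hrk : Module.rank ℤ_[p] (T ⧸ Submodule.span ℤ_[p] ({q • b 0} : Set T)) = 1 := by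
    have h21 : (2 : Cardinal) = 1 + 1 := by norm_num
    rw [h21] at hadd
    exact Cardinal.eq_of_add_eq_add_right hadd Cardinal.one_lt_aleph0
  rw [hrange]
  exact Module.finrank_eq_of_rank_eq hrk

end Literature.NumberTheory.EllipticCurves.Kato2004

end
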